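import Summits.BirchSwinnertonDyer.BirchSwinnertonDyer.Theorems.KolyvaginDepthDoorDepthTableKuriharaRow571b1Eleven
import HarnessLib

/-!
# Route `KolyvaginDepthDoor`, crux `KolyvaginDepthSupplyKN` (stmt-BirchSwinnertonDyer-22820) —
# DEPTH TABLE v17, ROW `571b1` IN THE KURIHARA CURRENCY AT `p = 13` (`d_K = −7`; part 2 of 2): one more admissible prime for the
# third closed curve, from the tree records `cert_571b1` = `(11, 2113·4159)`, `(13, 53·1847)` and `cert_27979d1` = `(11, 1013)`, `(13, 53)`

Helper file of the lead prover of line `levelone` (kdd-p1 g21; `--supports stmt-BirchSwinnertonDyer-22820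
--as helper`); it closes nothing and BSD is NOT proved by it.

Sequel of `KolyvaginDepthDoorDepthTableKuriharaRow571b1` (twist model `T₀ = [0,−1,1,−212,−1184] = 27979d1 = 571b1^{(−7)}`, the `p = 5` row).
`(−7/11) = 1` (split), `(−7/13) = −1` (inert): W. Zhang's ♠ supply serves both (`571` prime). Kernel side conditions: `a_11(E) = −3`,
`a_13(E) = −5` (good ordinary, non-anomalous), `ρ̄_{E,11}`, `ρ̄_{E,13}` onto (semistable + no-root witnesses `a_5 = −2` mod `11`,
`a_3 = −2` mod `13`), levels `2113, 4159 ∈ 𝒫₁(E,11)`, `53, 1847 ∈ 𝒫₁(E,13)`, `1013 ∈ 𝒫₁(T₀,11)`, `53 ∈ 𝒫₁(T₀,13)` with cyclic `p`-parts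
(`#Ẽ(𝔽₂₁₁₃) = 2068`, `#Ẽ(𝔽₄₁₅₉) = 4246`, `#Ẽ(𝔽₅₃) = 52`, `#Ẽ(𝔽₁₈₄₇) = 1872`, `#T̃₀(𝔽₁₀₁₃) = 1023`, `#T̃₀(𝔽₅₃) = 52`), `a_11(T₀) = −3`,
`a_13(T₀) = 5` (non-anomalous), Kodaira–Néron for `T₀` at `11`, `13` (exponents `6, 1`).

* `cruxBody_of_kuriharaClaims_13_neg7` — the row at `13` (shape and point counts in part 1, `…Row571b1Eleven`).

CONDITIONAL on Kim 2026 Thm. 1.11, modularity, Mazur 1978 Cor. 4.1, W. Zhang 2014 L8.4 (1)/9.1 BY NAME and the record claims at the prime;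
per curve; nothing class-wide (the open stub (S♭) is untouched); BSD is NOT proved by it.

References: [Kim2022StructureSelmer] Thm. 1.11; [WZhang2014] Lemma 8.4 (1), Thm. 9.1; [Mazur1978] Cor. 4.1, Prop. 6.3 (1); [Serre1972] §4.2,
§5.4 Prop. 21; [CremonaAlgorithms1997] Table 1 (571b1); [SilvermanAEC2009] VII.3.1, VII.5.1.
-/

set_option linter.dupNamespace false

noncomputable section

open scoped Classical NumberField

namespace Summit.BirchSwinnertonDyer.BirchSwinnertonDyer.Theorems.KolyvaginDepthDoor

open Literature.NumberTheory.EllipticCurves Literature.NumberTheory.EllipticCurves.ModularForms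
  WeierstrassCurve NumberField IsDedekindDomain
open Summit.BirchSwinnertonDyer.BirchSwinnertonDyer.Theorems
open Summit.BirchSwinnertonDyer.BirchSwinnertonDyer.Rank2Observatory
open Summit.BirchSwinnertonDyer.BirchSwinnertonDyer.Rank1Residual (IntModel.frobeniusTrace_eq)
open Summit.BirchSwinnertonDyer.Rank1Residual.Supersingular (natCard_point_eq_of_countPoints countPoints_eq_of_fast)
open Summit.BirchSwinnertonDyer.Rank1Residual.Additive (card_torsion_le_of_intModel_of_card
  isKolyvaginPrime_of_intModel_of_card isKolyvaginProduct_mul)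

namespace C571b1

/-! ## `p = 13`: admissibility, the E-level `53·1847`, the twist level `53` -/

/-- **`13` is good ordinary for `571b1`** (`13 ∤ 571`, `a_13 = -5`). [cite: CremonaAlgorithms1997, Table 1 (571b1)] -/
theorem goodOrdinary_13 :
    haveI := Fact.mk (by norm_num : Nat.Prime 13); haveI := isGloballyMinimal_c571b1;
    ((⟨0, 1, 1, -4, 2⟩ : WeierstrassCurve ℤ).map (Int.castRingHom ℚ)).HasGoodReductionAtPrime 13 ∧ ¬ ((13 : ℕ) : ℤ) ∣ ((⟨0, 1, 1, -4, 2⟩ : WeierstrassCurve ℤ).map (Int.castRingHom ℚ)).frobeniusTrace 13 := by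
  haveI := Fact.mk (by norm_num : Nat.Prime 13)
  haveI := isElliptic_c571b1; haveI := isGloballyMinimal_c571b1
  exact goodOrdinary_of_intModel_certificate intModel 13 (by decide +kernel) (n := 19) card_13 (by decide +kernel)

/-- **`ρ̄_{E,13}` is surjective for `571b1`**: semistable and `X² − a_3X + 3` (`a_3 = -2`) has no root mod `13` (Mazur Prop. 6.3 (1), Serre
Prop. 21). [cite: Serre1972, §5.4 Prop. 21] [cite: Mazur1978, §6 Prop. 6.3 (1)] -/
theorem hasSurjectiveModNGaloisRep_13 :
    haveI := isElliptic_c571b1; ((⟨0, 1, 1, -4, 2⟩ : WeierstrassCurve ℤ).map (Int.castRingHom ℚ)).HasSurjectiveModNGaloisRep (13 : ℕ) := by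
  have hn : ∀ t : ZMod 13, t ^ 2 - (((3 : ℕ) : ℤ) + 1 - (6 : ℕ) : ℤ) * t + ((3 : ℕ) : ZMod 13) ≠ 0 := by
    decide +kernel
  haveI := Fact.mk (by norm_num : Nat.Prime 13); haveI := Fact.mk (by norm_num : Nat.Prime 3)
  haveI := isElliptic_c571b1; haveI := isGloballyMinimal_c571b1
  exact hasSurjectiveModNGaloisRep_of_intModel_certificate intModel
    (by rw [Int.isCoprime_iff_gcd_eq_one]; decide +kernel) 13 3 (by norm_num) (by decide +kernel)
    (n := 6) card_3 hn

/-- **`13` is non-anomalous for `571b1`** (`a_13 − 1 = -6`) and for `T₀` (`a_13(T₀) − 1 = 4`). [cite: SilvermanAEC2009, VII.3 Prop. 3.1] -/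
theorem nonAnomalous_13 :
    haveI := isGloballyMinimal_c571b1; haveI := minTwist7_isGloballyMinimal; haveI := Fact.mk (by norm_num : Nat.Prime 13);
    ¬ ((13 : ℕ) : ℤ) ∣ ((⟨0, 1, 1, -4, 2⟩ : WeierstrassCurve ℤ).map (Int.castRingHom ℚ)).frobeniusTrace 13 - 1 ∧ ¬ ((13 : ℕ) : ℤ) ∣ ((⟨0, -1, 1, -212, -1184⟩ : WeierstrassCurve ℤ).map (Int.castRingHom ℚ)).frobeniusTrace 13 - 1 := by
  haveI := isElliptic_c571b1; haveI := isGloballyMinimal_c571b1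
  haveI := minTwist7_isElliptic; haveI := minTwist7_isGloballyMinimal
  haveI := Fact.mk (by norm_num : Nat.Prime 13)
  rw [IntModel.frobeniusTrace_eq intModel card_13, IntModel.frobeniusTrace_eq minTwist7_intModel minTwist7_card_13]
  decide

/-- **`97891 = 53·1847` is a cyclic Kolyvagin level for `(571b1, 13)`** — the level of `cert_571b1` at `p = 13`. [cite: Kim2022StructureSelmer, §1.2.2 (PDF p. 5)] -/
theorem isCyclicKolyvaginLevel_13_97891 :
    haveI := isGloballyMinimal_c571b1; haveI := Fact.mk (by norm_num : Nat.Prime 13);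
    IsCyclicKolyvaginLevel ((⟨0, 1, 1, -4, 2⟩ : WeierstrassCurve ℤ).map (Int.castRingHom ℚ)) 13 97891 := by
  haveI := isElliptic_c571b1; haveI := isGloballyMinimal_c571b1
  haveI := Fact.mk (by norm_num : Nat.Prime 13)
  haveI : Fact (Nat.Prime 53) := ⟨by norm_num⟩
  haveI : Fact (Nat.Prime 1847) := ⟨by norm_num⟩
  have h₁ : Kato.IsKolyvaginPrime ((⟨0, 1, 1, -4, 2⟩ : WeierstrassCurve ℤ).map (Int.castRingHom ℚ)) 13 1 53 :=
    isKolyvaginPrime_of_intModel_of_card intModel 13 1 53 (by norm_num) (by decide +kernel) (by decide) card_53 (by norm_num)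
  have h₂ : Kato.IsKolyvaginPrime ((⟨0, 1, 1, -4, 2⟩ : WeierstrassCurve ℤ).map (Int.castRingHom ℚ)) 13 1 1847 :=
    isKolyvaginPrime_of_intModel_of_card intModel 13 1 1847 (by norm_num) (by decide +kernel) (by decide) card_1847 (by norm_num)
  refine ⟨by simpa using isKolyvaginProduct_mul h₁ h₂ (by norm_num), fun ℓ hℓ hdvd ↦ ?_⟩
  rw [show (97891 : ℕ) = 53 * 1847 from rfl] at hdvd
  rcases (Nat.Prime.dvd_mul hℓ.out).mp hdvd with h | h
  · obtain rfl := (Nat.prime_dvd_prime_iff_eq hℓ.out (by norm_num)).mp h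
    exact card_torsion_le_of_intModel_of_card intModel 13 53 card_53 (by norm_num)
  · obtain rfl := (Nat.prime_dvd_prime_iff_eq hℓ.out (by norm_num)).mp h
    exact card_torsion_le_of_intModel_of_card intModel 13 1847 card_1847 (by norm_num)

/-- **`53` is a cyclic Kolyvagin level for `(T₀, 13)`** — the level of `cert_27979d1` at `p = 13`. [cite: Kim2022StructureSelmer, §1.2.2 (PDF p. 5)] -/
theorem minTwist7_isCyclicKolyvaginLevel_13_53 :
    haveI := minTwist7_isGloballyMinimal; haveI := Fact.mk (by norm_num : Nat.Prime 13);
    IsCyclicKolyvaginLevel ((⟨0, -1, 1, -212, -1184⟩ : WeierstrassCurve ℤ).map (Int.castRingHom ℚ)) 13 53 := by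
  haveI := minTwist7_isElliptic; haveI := minTwist7_isGloballyMinimal
  haveI := Fact.mk (by norm_num : Nat.Prime 13)
  haveI : Fact (Nat.Prime 53) := ⟨by norm_num⟩
  have h : Kato.IsKolyvaginPrime ((⟨0, -1, 1, -212, -1184⟩ : WeierstrassCurve ℤ).map (Int.castRingHom ℚ)) 13 1 53 :=
    isKolyvaginPrime_of_intModel_of_card minTwist7_intModel 13 1 53 (by norm_num) (by decide +kernel) (by decide)
      minTwist7_card_53 (by norm_num)
  refine ⟨⟨Nat.squarefree_iff_nodup_primeFactorsList (by norm_num) |>.mpr (by simp), fun ℓ hℓ ↦ ?_⟩, fun ℓ hℓ hdvd ↦ ?_⟩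
  · rw [show (53 : ℕ).primeFactors = {53} from (Nat.Prime.primeFactors (by norm_num)), Finset.mem_singleton] at hℓ
    exact hℓ ▸ h
  · obtain rfl := (Nat.prime_dvd_prime_iff_eq hℓ.out (by norm_num)).mp hdvd
    exact card_torsion_le_of_intModel_of_card minTwist7_intModel 13 53 minTwist7_card_53 (by norm_num)

/-- **Kodaira–Néron for `T₀` at `13`**: `|Δ(T₀)| = 7⁶·571 < 5^13` and no prime `< 5` divides it, so every multiplicative place has
exponent `< 13` (table lemma, vacuous table). [cite: SilvermanAEC2009, VII.5.1, VIII.8] -/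
theorem minTwist7_kodairaNeron_13 :
    haveI := minTwist7_isElliptic; haveI := minTwist7_isGloballyMinimal;
    ∀ v : HeightOneSpectrum (𝓞 ℚ), ((⟨0, -1, 1, -212, -1184⟩ : WeierstrassCurve ℤ).map (Int.castRingHom ℚ)).HasMultiplicativeReductionAt v → ¬ 13 ∣ ((⟨0, -1, 1, -212, -1184⟩ : WeierstrassCurve ℤ).map (Int.castRingHom ℚ)).ordMinimalDiscriminant v := by
  haveI := minTwist7_isElliptic; haveI := minTwist7_isGloballyMinimal
  refine not_dvd_ordMinimalDiscriminant_of_intModel_table minTwist7_intModel (p := 13) (Δ₀ := (-67177579))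
    (by decide +kernel) (B := 5) (by decide +kernel) ?_
  intro q hq hqP hqd
  exfalso
  have hqB : q < 5 := Finset.mem_range.mp hq
  interval_cases q <;> first | (norm_num at hqP; done) | exact absurd hqd (by decide)

/-- **DEPTH-TABLE ROW `571b1`, `(p, d_K) = (13, −7)`, v17** — the clause of `KolyvaginDepthSupplyKN` at `571b1` with witness prime `13`
(INERT in `ℚ(√−7)`), from the CLAIMS of `cert_571b1` @ `(13, 53·1847)` and `cert_27979d1` @ `(13, 53)`, CONDITIONAL on Kim Thm. 1.11,
modularity, Mazur Cor. 4.1, W. Zhang L8.4 (1)/9.1 BY NAME; per curve; BSD is not proved by it.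
[cite: Kim2022StructureSelmer, Thm. 1.11 (PDF p. 8)] [cite: WZhang2014, Lemma 8.4 (1) (p. 236), Thm. 9.1 (p. 240)] [cite: Mazur1978, Cor. 4.1] -/
theorem cruxBody_of_kuriharaClaims_13_neg7
    (hKim : Kim2022_card_selmerGroup_le_pow_of_kuriharaNumber_ne_zero)
    (hnf : exists_isNewformOf) (hMaz : mazur_not_dvd_maninConstant_of_odd)
    (h84 : Literature.NumberTheory.EllipticCurves.WZhang2014_lemma84_exists_minimal_kolyvaginClass_one_selmerCard)
    (K : Type) [Field K] [NumberField K] (hK : IsImaginaryQuadratic K) (hD : NumberField.discr K = -7)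
    (hδE : haveI := isElliptic_c571b1; haveI := isGloballyMinimal_c571b1;
      haveI : NeZero (((⟨0, 1, 1, -4, 2⟩ : WeierstrassCurve ℤ).map (Int.castRingHom ℚ)).conductorNorm ℤ) := neZero_conductorNorm_of_isElliptic _;
      haveI := Fact.mk (by norm_num : Nat.Prime 13);
      ∀ (D : ModularParametrizationData ((⟨0, 1, 1, -4, 2⟩ : WeierstrassCurve ℤ).map (Int.castRingHom ℚ)) (((⟨0, 1, 1, -4, 2⟩ : WeierstrassCurve ℤ).map (Int.castRingHom ℚ)).conductorNorm ℤ)), ¬ ((13 : ℕ) : ℤ) ∣ D.maninConstant →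
        (∃ u : ℚ, ‖(u : ℚ_[13])‖ = 1 ∧ ((⟨0, 1, 1, -4, 2⟩ : WeierstrassCurve ℤ).map (Int.castRingHom ℚ)).realPeriodRat = u * plusPeriod D.f) →
        ∃ ψ : (ℓ : ℕ) → (ZMod ℓ)ˣ →* Multiplicative (ZMod 13),
          (∀ ℓ ∈ (97891 : ℕ).primeFactors, Function.Surjective (ψ ℓ)) ∧ kuriharaNumber D.f 13 97891 ψ ≠ 0)
    (hδT : haveI := minTwist7_isElliptic; haveI := minTwist7_isGloballyMinimal;
      haveI : NeZero (((⟨0, -1, 1, -212, -1184⟩ : WeierstrassCurve ℤ).map (Int.castRingHom ℚ)).conductorNorm ℤ) := neZero_conductorNorm_of_isElliptic _;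
      haveI := Fact.mk (by norm_num : Nat.Prime 13);
      ∀ (D : ModularParametrizationData ((⟨0, -1, 1, -212, -1184⟩ : WeierstrassCurve ℤ).map (Int.castRingHom ℚ)) (((⟨0, -1, 1, -212, -1184⟩ : WeierstrassCurve ℤ).map (Int.castRingHom ℚ)).conductorNorm ℤ)), ¬ ((13 : ℕ) : ℤ) ∣ D.maninConstant →
        (∃ u : ℚ, ‖(u : ℚ_[13])‖ = 1 ∧ ((⟨0, -1, 1, -212, -1184⟩ : WeierstrassCurve ℤ).map (Int.castRingHom ℚ)).realPeriodRat = u * plusPeriod D.f) →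
        ∃ ψ : (ℓ : ℕ) → (ZMod ℓ)ˣ →* Multiplicative (ZMod 13),
          (∀ ℓ ∈ (53 : ℕ).primeFactors, Function.Surjective (ψ ℓ)) ∧ kuriharaNumber D.f 13 53 ψ ≠ 0) :
    haveI := isElliptic_c571b1; haveI := isGloballyMinimal_c571b1;
    ∃ (p : ℕ) (hp : Fact p.Prime), 5 ≤ p ∧ ((⟨0, 1, 1, -4, 2⟩ : WeierstrassCurve ℤ).map (Int.castRingHom ℚ)).HasGoodReductionAtPrime p ∧
      ¬ (p : ℤ) ∣ ((⟨0, 1, 1, -4, 2⟩ : WeierstrassCurve ℤ).map (Int.castRingHom ℚ)).frobeniusTrace p ∧ (∀ n : ℕ, ((⟨0, 1, 1, -4, 2⟩ : WeierstrassCurve ℤ).map (Int.castRingHom ℚ)).HasSurjectiveModNGaloisRep (p ^ n : ℕ)) ∧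
      (∀ v : HeightOneSpectrum (𝓞 ℚ), ((⟨0, 1, 1, -4, 2⟩ : WeierstrassCurve ℤ).map (Int.castRingHom ℚ)).HasMultiplicativeReductionAt v → ¬ p ∣ ((⟨0, 1, 1, -4, 2⟩ : WeierstrassCurve ℤ).map (Int.castRingHom ℚ)).ordMinimalDiscriminant v) ∧
      ∃ (K : Type) (_ : Field K) (_ : NumberField K), IsImaginaryQuadratic K ∧
        NumberField.discr K ≠ -3 ∧ NumberField.discr K ≠ -4 ∧
        ∃ (_ : NeZero (((⟨0, 1, 1, -4, 2⟩ : WeierstrassCurve ℤ).map (Int.castRingHom ℚ)).conductorNorm ℤ)), SatisfiesHeegnerHypothesis (((⟨0, 1, 1, -4, 2⟩ : WeierstrassCurve ℤ).map (Int.castRingHom ℚ)).conductorNorm ℤ) K ∧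
        ∃ (Dt : ModularParametrizationData ((⟨0, 1, 1, -4, 2⟩ : WeierstrassCurve ℤ).map (Int.castRingHom ℚ)) (((⟨0, 1, 1, -4, 2⟩ : WeierstrassCurve ℤ).map (Int.castRingHom ℚ)).conductorNorm ℤ)) (β : ℤ) (ι : K →+* ℂ) (n₁ : ℕ)
          (d : KolyvaginHeegnerData Dt β ι n₁), Squarefree n₁ ∧
          (∀ q ∈ n₁.primeFactors, Zhang2014.IsKolyvaginPrime (((⟨0, 1, 1, -4, 2⟩ : WeierstrassCurve ℤ).map (Int.castRingHom ℚ)).conductorNorm ℤ) ((⟨0, 1, 1, -4, 2⟩ : WeierstrassCurve ℤ).map (Int.castRingHom ℚ)) K p q) ∧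
          d.kolyvaginClass hp.out 1 ≠ 0 ∧
          (n₁.primeFactors.card + 1 ≤ ((⟨0, 1, 1, -4, 2⟩ : WeierstrassCurve ℤ).map (Int.castRingHom ℚ)).mordellWeilRank ∨
            (n₁.primeFactors.card ≤ ((⟨0, 1, 1, -4, 2⟩ : WeierstrassCurve ℤ).map (Int.castRingHom ℚ)).mordellWeilRank ∧
              n₁.primeFactors.card + 1 ≤ (((⟨0, 1, 1, -4, 2⟩ : WeierstrassCurve ℤ).map (Int.castRingHom ℚ)).quadraticTwist (NumberField.discr K : ℚ)).mordellWeilRank)) := by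
  haveI := isElliptic_c571b1; haveI := isGloballyMinimal_c571b1
  haveI iP := Fact.mk (by norm_num : Nat.Prime 13)
  haveI : NeZero (97891 : ℕ) := ⟨by norm_num⟩
  haveI : NeZero (53 : ℕ) := ⟨by norm_num⟩
  have hν : (97891 : ℕ).primeFactors.card ≤ 2 := by
    rw [show (97891 : ℕ) = 53 * 1847 from rfl, Nat.primeFactors_mul (by norm_num) (by norm_num),
      Nat.Prime.primeFactors (by norm_num), Nat.Prime.primeFactors (by norm_num)]
    decide
  have hμ : (53 : ℕ).primeFactors.card ≤ 2 := by
    rw [Nat.Prime.primeFactors (by norm_num), Finset.card_singleton]; omega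
  exact cruxBody_of_kuriharaClaims_neg7_at hKim hnf hMaz h84 13 (by norm_num) (by norm_num) goodOrdinary_13.1 goodOrdinary_13.2
    hasSurjectiveModNGaloisRep_13 nonAnomalous_13.1 K hK hD 97891 isCyclicKolyvaginLevel_13_97891 hν hδE
    nonAnomalous_13.2 minTwist7_kodairaNeron_13 53 minTwist7_isCyclicKolyvaginLevel_13_53 hμ hδT

end C571b1

end Summit.BirchSwinnertonDyer.BirchSwinnertonDyer.Theorems.KolyvaginDepthDoor

end
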